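import Summits.QuantumFields.YangMills.Theorems.BalabanUVNodesN15KingModelOSReflectionPositivity

/-!
# BalabanUVNodes ∕ N15 — THE KING-MODEL RUNG (PART Ͳ-h): REFLECTION POSITIVITY OF `μ_∞` ON ALL BOUNDED OBSERVABLES IN EVERY LATTICE DIRECTION
# (Track A, DAG node N15 = NE2; FAN-OUT v1.1 §N15 s3 «KING-MODEL RUNG»; count-neutral)

HONEST FRAMING.  Count-neutral (cell `pub-ymgap`, seat `pub-ymgap-dag-n15-e` g36; `--supports stmt-QuantumFields-27366 --as helper` = K3⁸).  King's `A = 0`, `g = 0` model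
([King1986] C. King, Commun. Math. Phys. **102** (1986) 649–677).  Part Ͳ-c₁ proved reflection positivity of King's infinite-volume block field `μ_∞` on ALL bounded observables of the
half `{x₀ ≥ 0}` for the TIME reflection; by the hyperoctahedral symmetry of `S₂^{ℝ}` the same holds in EVERY direction `ν`: ★★★ **`king_isReflectionPositive_dir`** — for the block reflection
`θ_ν z = (z_⊥, −z_ν − 1)` (as a permutation of `ℤ^{d+1}`, `Function.Involutive.toPerm`) and the half `{z_ν ≥ 0}`, `IsReflectionPositive μ_∞ θ_ν {z_ν ≥ 0}` (part Ϸ-k's covariance RP in direction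
`ν` + the generic Gaussian coupling theorem).  NOT Bałaban's objects; NOT a node discharge; nothing continuum ∕ `ℝ⁴` ∕ Clay.  0 `sorry`, 0 def; standard axioms.

WHAT THIS FILE PROVES (kernel).  `blockReflect_involutive`, `kingKernel_blockReflect`, `sum_sum_kingKernel_blockReflect_nonneg`, ★★★ **`king_isReflectionPositive_dir`**, `king_isReflectionInvariant_dir`.

HONEST SCOPE.  King's free infinite-volume block field (`m² > 0`, every `d`, every direction).  N15 untouched; counts unmoved.
Locators (use): [King1986] Thm 2.1 (2.22) p.654, (4.5) p.670; Glimm–Jaffe 1987 §6.2 Thm. 6.2.2; FILS 1978 §2.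
-/

noncomputable section

open scoped BigOperators
open MeasureTheory ProbabilityTheory Finset

namespace Summit.QuantumFields.YangMills.BalabanUVNodes.N15KingModelRung.InfiniteVolume

open Literature.MathematicalPhysics.QuantumFieldTheory (IsPosSemidefKernel gaussianFieldOfKernel)
open Literature.Probability.LatticeModels (IsReflectionInvariant IsReflectionPositive gaussianField_isReflectionPositive gaussianField_isReflectionInvariant)
open Summit.QuantumFields.YangMills.BalabanUVNodes.N15KingModelRung.OptimalDecay

variable {d : ℕ}

/-- The block reflection `θ_ν z = (z_⊥, −z_ν − 1)` is an involution. [cite: FILS1978, §2] -/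
theorem blockReflect_involutive (ν : Fin (d + 1)) : Function.Involutive fun z : Fin (d + 1) → ℤ => Function.update z ν (-(z ν) - 1) := by
  intro z
  ext μ
  by_cases h : μ = ν
  · subst h; simp
  · simp [h]

/-- `K(θ_ν z, θ_ν w) = K(z, w)` (part Ϻ-o). [cite: King1986, Thm 2.1 (2.22) p.654] -/
theorem kingKernel_blockReflect (m2 : ℝ) (ν : Fin (d + 1)) (z w : Fin (d + 1) → ℤ) :
    kingKernel m2 ((blockReflect_involutive ν).toPerm _ z) ((blockReflect_involutive ν).toPerm _ w) = kingKernel m2 z w := by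
  simp only [Function.Involutive.coe_toPerm]
  rw [kingKernel_apply, kingKernel_apply, kingS2Inf_reflect_sub_reflect]

/-- The reflected Gram sums in direction `ν` on the half `{z_ν ≥ 0}` are non-negative (part Ϸ-k). [cite: King1986, Thm 2.1 (2.22) p.654, (4.5) p.670] -/
theorem sum_sum_kingKernel_blockReflect_nonneg {m2 : ℝ} (hm : 0 < m2) (ν : Fin (d + 1)) (ι : Type) (s : Finset ι) (c : ι → ℝ) (z : ι → Fin (d + 1) → ℤ)
    (hz : ∀ i ∈ s, z i ∈ {x : Fin (d + 1) → ℤ | 0 ≤ x ν}) :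
    0 ≤ ∑ i ∈ s, ∑ j ∈ s, c i * c j * kingKernel m2 ((blockReflect_involutive ν).toPerm _ (z i)) (z j) := by
  have h := kingS2Inf_reflection_positive hm ν s c z fun i hi => hz i hi
  refine h.trans_eq (Finset.sum_congr rfl fun i _ => Finset.sum_congr rfl fun j _ => ?_)
  simp only [Function.Involutive.coe_toPerm]
  rw [kingKernel_apply, ← kingS2Inf_neg m2 (z j - _), neg_sub]

/-- ★★★ **`μ_∞` IS REFLECTION POSITIVE ON ALL BOUNDED OBSERVABLES OF THE HALF `{z_ν ≥ 0}`, IN EVERY DIRECTION `ν`** (Euclidean symmetry of King's block field; Glimm–Jaffe Thm. 6.2.2).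
[cite: King1986, Thm 2.1 (2.22) p.654; GlimmJaffe1987, §6.2 Thm. 6.2.2; FILS1978, §2] -/
theorem king_isReflectionPositive_dir {m2 : ℝ} (hm : 0 < m2) (ν : Fin (d + 1)) :
    IsReflectionPositive (kingFieldInf (d := d) m2) ((blockReflect_involutive ν).toPerm _) {x : Fin (d + 1) → ℤ | 0 ≤ x ν} :=
  gaussianField_isReflectionPositive (isPosSemidefKernel_kingKernel hm) _ (kingKernel_blockReflect m2 ν)
    (fun z => by simp only [Function.Involutive.coe_toPerm]; exact blockReflect_involutive ν z) (sum_sum_kingKernel_blockReflect_nonneg hm ν)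

/-- `μ_∞` is invariant under the block reflection in every direction (part Ϻ-p, re-read as `IsReflectionInvariant`). [cite: King1986, Thm 2.1 (2.22) p.654] -/
theorem king_isReflectionInvariant_dir {m2 : ℝ} (hm : 0 < m2) (ν : Fin (d + 1)) :
    IsReflectionInvariant (kingFieldInf (d := d) m2) ((blockReflect_involutive ν).toPerm _) :=
  gaussianField_isReflectionInvariant (isPosSemidefKernel_kingKernel hm) _ (kingKernel_blockReflect m2 ν)

end Summit.QuantumFields.YangMills.BalabanUVNodes.N15KingModelRung.InfiniteVolume
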